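import Summits.BirchSwinnertonDyer.Rank1Residual.X11b.ShapiroPairsRankZero
import Summits.BirchSwinnertonDyer.Rank1Residual.X11a.ChaRecords2
import Summits.BirchSwinnertonDyer.Rank1Residual.X11a.DescentPairsThree
import HarnessLib

/-!
# Route `PrintX11a` (cell `bsd-print-x11a`): the BC5 RUNGS of the children U5 `UpperNonSurjFive`
# (item stmt-BirchSwinnertonDyer-20614) and U3 `UpperNonSurjThree` (item 20613) of crux 3
# `X11aNonSurjEulerHalf`, re-exported BY NAME as instances of the CHILD BODIES
# (PLAN v4.2 §2 p3 (4), tribunal hygiene; `--supports stmt-BirchSwinnertonDyer-20614 --as helper`)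

U5 reads `∀ W p, ClassX11a W p → ¬ Surj W p → 5 ≤ p → Typed.MissingUpperBoundAt W p`; U3 the same with
`p = 3`. This file DECIDES the body `Typed.MissingUpperBoundAt W p` (the Euler-system half
`ord_p #Ш ≤ ord_p #Ш_an`) at three pairs of their domains lying OUTSIDE print's regime (image neither
surjective nor Borel, so Wuthrich 2014 Prop. 21 / Kato Thm. 17.4 do not apply):

* `upperNonSurjFive_rung_118080ds1` (the `BSDp` form is `X11b.bsdp_s118080ds1` itself, not re-declared) — `118080ds1 @ 5` (`N = 2⁶·3²·5·41`, `5 ∥ N` split multiplicative,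
  image `5Ns`, `r_an = 0`, `#Ш_an = 1`): from the tree's EXACT, GRH-free Shapiro `5`-descent record
  `X11b.bsdp_s118080ds1` (`#Sel^(5)(E/ℚ) = 1`; file `X11b/ShapiroPairsRankZero.lean`) + GZK finiteness +
  `Typed.missingPPartAt_of_bsdp` — the route's `tribunal_fit.witness`;
* `upperNonSurjFive_rung_184960w1` — `184960w1 @ 5` (`N = 2⁷·5·17²`, non-split, image `5S4`): p4's
  Heegner-index socket `X11a.ChaRecords.mub5_c184960w1` (Cha 2005 Thm 21 / Miller Thm 5.2 with the
  displayed two-engine Heegner datum of ty3) re-exported by name;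
* `upperNonSurjThree_rung_184512cx1` — `184512cx1 @ 3` (`N = 2⁶·3·31²`, non-split, image `3Nn`): from
  the EXACT, GRH-free Schaefer–Stoll `3`-descent record `X11a.bsdp3_s184512cx1` (file
  `X11a/DescentPairsThree.lean`, engines desc3lib.gp / desc3full_e2.py equal value for value) —
  the planner g3's `U3_rung.lean` (evidence #3 on item 20613) verbatim, re-homed here.

Displayed binders exactly as in the records (`hGZK`, `r_an ≤ 1`, `#Ш_an` a `p`-adic unit, the
certificate line `hSel` / the Heegner datum). HONEST FRAMING: per pair (E1 currency), never the leaf;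
proves no item; theorems only, no definition, no named fact, no `sorry`; beyond-print theorem: no.
References: [Miller2011LMS] §1, Def. 1.1, Thm. 5.2; [SchaeferStoll2004]; [Cremona2006] Table 1;
HOME/PLAN.md v4.2 §2 p3 (4), HOME/staging/plan/U3_rung.lean.
-/

set_option autoImplicit false

noncomputable section

open scoped Classical

open WeierstrassCurve Literature.NumberTheory.EllipticCurves
  Literature.NumberTheory.EllipticCurves.Rank1Residual
  Literature.NumberTheory.EllipticCurves.Rank1Residual.Typed
  Literature.NumberTheory.EllipticCurves.Rank1Residual.X11RankOneCertificates
  Literature.NumberTheory.EllipticCurves.Cha2005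
  Summit.BirchSwinnertonDyer.Rank1Residual Summit.BirchSwinnertonDyer.Rank1Residual.X11b

namespace Summit.BirchSwinnertonDyer.Rank1Residual.X11a.PrintRungs

/-- **BC5 rung for U5 (the route's `tribunal_fit.witness`)**: `Typed.MissingUpperBoundAt W 5` — the body
of `PrintX11a.UpperNonSurjFive` — at the rank-0 `5Ns` X11a pair `118080ds1`, from the exact Shapiro
`5`-descent record `X11b.bsdp_s118080ds1` (`BSDp W 5`) read back through `Typed.missingPPartAt_of_bsdp`.
[cite: Miller2011LMS, §1 and Def. 1.1] [cite: Cremona2006, Table 1 (Cremona label 118080ds1)] -/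
theorem upperNonSurjFive_rung_118080ds1 (hGZK : rank_eq_analyticRank_of_analyticRank_le_one)
    (W : WeierstrassCurve ℚ) (hW : W = ⟨0, 0, 0, -6839532, -6923887344⟩)
    (hr : W.analyticRank ≤ 1) {q : ℚ} (hq : shaAn W = (q : ℂ)) (hv : padicValRat 5 q = 0)
    (hSel : Nat.card (W.selmerGroup (5 : ℤ)) = 5 ^ W.analyticRank) :
    Typed.MissingUpperBoundAt W 5 := by
  haveI : Fact (Nat.Prime 5) := ⟨by norm_num⟩
  have hB : BSDp W 5 := X11b.bsdp_s118080ds1 hGZK W hW hr hq hv hSel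
  haveI hI : W.IsElliptic := by
    subst hW
    exact X11b.isElliptic_of_discOf_ne_zero 0 0 0 (-6839532) (-6923887344) (by decide +kernel)
  haveI : Finite W.sha := (hGZK W hr).2
  exact (Typed.lower_and_upper_of_missingPPartAt W 5 (Typed.missingPPartAt_of_bsdp W 5 hB)).2

/-- **Second U5 rung (non-split `5S4`)**: `Typed.MissingUpperBoundAt W 5` at `184960w1` = p4's Heegner-index
socket `X11a.ChaRecords.mub5_c184960w1` re-exported by name (Cha 2005 Thm 21 / Miller 2011 Thm 5.2, `hCha`;
the Heegner datum `K, P` with `5 ∤ [E(K) : ℤP]` displayed — ty3's two-engine certificate row).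
[cite: Miller2011LMS, Thm. 5.2 and Def. 1.1] [cite: Cremona2006, Table 1 (Cremona label 184960w1)] -/
theorem upperNonSurjFive_rung_184960w1 (hCha : thm52_padicValNat_shaOrder_le)
    (W : WeierstrassCurve ℚ) (hW : W = ⟨0, 1, 0, -2221, 39979⟩)
    {N : ℕ} [NeZero N] {K : Type} [Field K] [NumberField K] (hK : IsImaginaryQuadratic K)
    (hH : SatisfiesHeegnerHypothesis N K) {P : (W.baseChange K).toAffine.Point}
    (hP : IsHeegnerPoint N W K P) (hnt : ¬ IsOfFinAddOrder P)
    (hpD : ¬ (5 : ℤ) ∣ NumberField.discr K) (hpN : ¬ 5 ^ 2 ∣ N)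
    (hI : padicValNat 5 (AddSubgroup.zmultiples P).index ≤ 0)
    (hr : W.analyticRank ≤ 1) {q : ℚ} (hq : shaAn W = (q : ℂ)) (hv : (0 : ℤ) ≤ padicValRat 5 q) :
    Typed.MissingUpperBoundAt W 5 :=
  X11a.ChaRecords.mub5_c184960w1 hCha W hW hK hH hP hnt hpD hpN hI hr hq hv

/-- **BC5 rung for U3**: `Typed.MissingUpperBoundAt W 3` (the body of `PrintX11a.UpperNonSurjThree`) at the
rank-0 `3Nn` X11a pair `184512cx1`, from the exact `3`-descent record `X11a.bsdp3_s184512cx1` (planner g3's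
`U3_rung.lean`, evidence #3 on item 20613, verbatim). [cite: Miller2011LMS, §1 and Def. 1.1]
[cite: Cremona2006, Table 1 (Cremona label 184512cx1)] -/
theorem upperNonSurjThree_rung_184512cx1 (hGZK : rank_eq_analyticRank_of_analyticRank_le_one)
    (W : WeierstrassCurve ℚ) (hW : W = ⟨0, -1, 0, 4488511, 5105096097⟩)
    (hr : W.analyticRank ≤ 1) {q : ℚ} (hq : shaAn W = (q : ℂ)) (hv : padicValRat 3 q = 0)
    (hSel : Nat.card (W.selmerGroup (3 : ℤ)) = 3 ^ W.analyticRank) :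
    Typed.MissingUpperBoundAt W 3 := by
  haveI : Fact (Nat.Prime 3) := ⟨by norm_num⟩
  have hB : BSDp W 3 := X11a.bsdp3_s184512cx1 hGZK W hW hr hq hv hSel
  haveI hI : W.IsElliptic := by
    subst hW
    exact X11b.isElliptic_of_discOf_ne_zero 0 (-1) 0 4488511 5105096097 (by decide +kernel)
  haveI : Finite W.sha := (hGZK W hr).2
  exact (Typed.lower_and_upper_of_missingPPartAt W 3 (Typed.missingPPartAt_of_bsdp W 3 hB)).2

end Summit.BirchSwinnertonDyer.Rank1Residual.X11a.PrintRungs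

end
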